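import Summits.MatrixMultiplication.OmegaCensus.SmallFormats.MatMul22nDoubleCellKill
import HarnessLib

/-!
# ω-census family (a): an ALL-ONES row — every Gram block against a loaded column plane is non-zero and SINGULAR (any field)

Cell `pub-omega` (unit `pub-omega-tensor`, gen 40), topic `Summits/MatrixMultiplication/OmegaCensus` (sub-folder
`SmallFormats`). Framing (verbatim): lottery ticket; floor = certified bounds/negative ranges. HONEST FRAMING: M1-LEAN-BLUEPRINT F1(a) (memo DEFLATION-g40
§2(a)). Row cheap plane `span(c)` (from `loadedRowPlane_structure`), column cheap plane `span(b)` of a loaded column plane `C` (from `loadedColPlane_structure`,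
cheap-input vector `ν`): (i) if some term of `C` has its Y-form rows in `span(c)`, the Gram block `P l m = c l ⬝ᵥ b m` is NON-ZERO
(`AllOnesRow.gram_ne_zero`); (ii) if THREE terms with Y-form rows in `span(c)` and linearly independent Y-forms are all cheap for `C` (not in `C`), the Gram
block is SINGULAR (`AllOnesRow.gram_det_eq_zero`) — an invertible block would make all three Y-forms rank-one with the same column shape `m̂ = ν^⊥`, i.e. put three
independent forms into a 2-dimensional space. In an all-ones row (4 terms in 4 distinct column planes) both apply to every block. Nothing here is a bound on `ω`.
-/

namespace Summit.MatrixMultiplication.OmegaCensus.SmallFormats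

open Finset Module Matrix
open Literature.Computability.AlgebraicComplexity
open Summit.MatrixMultiplication.OmegaCensus.RankOnePlaneCapGeneral

namespace AllOnesRow

variable {k : Type*} [Field k] {n : ℕ} {ι : Type*} [Fintype ι]

/-- **Gram block non-zero.** If a term `t` of the loaded column plane (`t ∈ C`, cheap data `ν, b`) has its Y-form rows in `span(c)`, then some
`c l` pairs non-trivially with some `b m`. -/
theorem gram_ne_zero (β : BilinComp (mulBilin k 2 2 n) ι) (ν : Fin 2 → k) (hν : ν ≠ 0) (C : Finset ι) (hC4 : C.card = 4)
    (b : Fin 2 → (Fin n → k)) (hbi : ∀ a : Fin 2 → k, ∑ m, a m • b m = 0 → ∀ m, a m = 0)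
    (hbch : ∀ t, t ∉ C → ∀ m, β.g t (Matrix.vecMulVec ν (b m)) = 0) (c : Fin 2 → (Fin n → k)) (t : ι) (ht : t ∈ C)
    (hrows : ∀ κ : Fin 2, ∃ a : Fin 2 → k, (fun j => β.g t (Matrix.single κ j (1 : k))) = ∑ m, a m • c m) :
    ∃ l m, c l ⬝ᵥ b m ≠ 0 := by
  classical
  obtain ⟨m₀, hm⟩ := ColumnSubcomp.sees_cheap_input β ν hν C hC4 b hbi hbch t ht
  by_contra hno
  push Not at hno
  apply hm
  rw [DoubleCellKill.g_vecMulVec_eq_combo_dot, sum_dotProduct]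
  refine Finset.sum_eq_zero fun κ _ => ?_
  obtain ⟨a, ha⟩ := hrows κ
  rw [smul_dotProduct, ha, sum_dotProduct]
  simp [smul_dotProduct, hno]

/-- **Gram block singular.** Three terms `t i` (`i : Fin 3`) outside the loaded column plane `C` (so cheap for it), with Y-form rows in `span(c 0, c 1)` and
linearly independent Y-forms, force `det P = 0` for the Gram block `P l m = c l ⬝ᵥ b m`. -/
theorem gram_det_eq_zero (β : BilinComp (mulBilin k 2 2 n) ι) (ν : Fin 2 → k) (hν : ν ≠ 0) (C : Finset ι)
    (b : Fin 2 → (Fin n → k)) (hbch : ∀ t, t ∉ C → ∀ m, β.g t (Matrix.vecMulVec ν (b m)) = 0) (c : Fin 2 → (Fin n → k))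
    (t : Fin 3 → ι) (htC : ∀ i, t i ∉ C)
    (hrows : ∀ i (κ : Fin 2), ∃ a : Fin 2 → k, (fun j => β.g (t i) (Matrix.single κ j (1 : k))) = ∑ m, a m • c m)
    (hind : LinearIndependent k (fun i => β.g (t i))) :
    (Matrix.of fun l m => c l ⬝ᵥ b m : Matrix (Fin 2) (Fin 2) k).det = 0 := by
  classical
  by_contra hdet
  -- each of the three Y-forms is rank one with column shape in ν^⊥: g_{t i}(Y) = ∑_{q,j} η_i q * g_i j * Y q j with ν ⬝ᵥ η_i = 0, g_i ∈ span(c)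
  have hnondeg : ∀ a : Fin 2 → k, (∀ m, (∑ l, a l • c l) ⬝ᵥ b m = 0) → ∑ l, a l • c l = 0 :=
    fun a h => GramNondeg.c_combo_eq_zero_of_perp c b hdet a h
  -- ν^⊥ is spanned by m̂ := (-ν 1, ν 0)
  set mhat : Fin 2 → k := ![-ν 1, ν 0] with hmhat
  have hperp : ∀ η : Fin 2 → k, ν ⬝ᵥ η = 0 → ∃ s : k, η = s • mhat := by
    intro η h
    simp only [dotProduct, Fin.sum_univ_two] at h
    by_cases h0 : ν 0 = 0
    · have h1 : ν 1 ≠ 0 := by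
        intro h1; apply hν; funext i; fin_cases i <;> simp [h0, h1]
      have : η 1 = 0 := by
        rw [h0, zero_mul, zero_add] at h
        exact (mul_eq_zero.mp h).resolve_left h1
      refine ⟨-(η 0) / ν 1, ?_⟩
      funext i; fin_cases i
      · simp [hmhat]; field_simp
      · simp [hmhat, this, h0]
    · refine ⟨η 1 / ν 0, ?_⟩
      funext i; fin_cases i
      · simp [hmhat]; field_simp; linear_combination h
      · simp [hmhat]; field_simp
  -- the linear map x ↦ (Y ↦ ∑ mhat q * x j * Y q j) on kⁿ, and the 2-dim target W = image of span(c)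
  let Φ : (Fin n → k) →ₗ[k] Module.Dual k (Matrix (Fin 2) (Fin n) k) :=
    { toFun := fun x =>
        { toFun := fun Y => ∑ q, ∑ j, mhat q * x j * Y q j
          map_add' := fun Y Y' => by simp only [Matrix.add_apply, mul_add, Finset.sum_add_distrib]
          map_smul' := fun s Y => by
            simp only [Matrix.smul_apply, smul_eq_mul, RingHom.id_apply, Finset.mul_sum]
            exact Finset.sum_congr rfl fun q _ => Finset.sum_congr rfl fun j _ => by ring }
      map_add' := fun x x' => by
        ext Y; simp only [LinearMap.coe_mk, AddHom.coe_mk, Pi.add_apply, LinearMap.add_apply, mul_add, add_mul,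
          Finset.sum_add_distrib]
      map_smul' := fun s x => by
        ext Y; simp only [LinearMap.coe_mk, AddHom.coe_mk, Pi.smul_apply, smul_eq_mul, RingHom.id_apply, LinearMap.smul_apply,
          Finset.mul_sum]
        exact Finset.sum_congr rfl fun q _ => Finset.sum_congr rfl fun j _ => by ring }
  let V : Submodule k (Fin n → k) := Submodule.span k (Set.range c)
  let W : Submodule k (Module.Dual k (Matrix (Fin 2) (Fin n) k)) := V.map Φ
  have hW2 : finrank k W ≤ 2 := by
    calc finrank k W ≤ finrank k V := Submodule.finrank_map_le Φ V
      _ ≤ (Finset.univ.image c).card := by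
          rw [show V = Submodule.span k ((Finset.univ.image c : Finset _) : Set _) by simp [V]]
          exact finrank_span_finset_le_card _
      _ ≤ 2 := Finset.card_image_le.trans (by simp)
  -- each g_{t i} lies in W
  have hmem : ∀ i, β.g (t i) ∈ W := by
    intro i
    set rows : Fin 2 → (Fin n → k) := fun κ j => β.g (t i) (Matrix.single κ j (1 : k)) with hrows_def
    have hrowsκ : ∀ κ, ∃ a : Fin 2 → k, rows κ = ∑ m, a m • c m := fun κ => hrows i κ
    have hcombo : ∑ κ, ν κ • rows κ = 0 := by
      refine RankOneShapes.combo_eq_zero_of_nondeg c b rows ν hrowsκ (fun m => ?_) hnondeg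
      rw [hrows_def, ← DoubleCellKill.g_vecMulVec_eq_combo_dot]; exact hbch (t i) (htC i) m
    obtain ⟨η, κ₀, hη⟩ := RankOneShapes.exists_rankOne_of_combo_eq_zero rows ν hν hcombo
    obtain ⟨a₀, ha₀⟩ := hrowsκ κ₀
    have hgV : rows κ₀ ∈ V := by
      rw [ha₀]; exact Submodule.sum_mem _ fun m _ => Submodule.smul_mem _ _ (Submodule.subset_span ⟨m, rfl⟩)
    have hentry : ∀ q j, β.g (t i) (Matrix.single q j (1 : k)) = η q * rows κ₀ j := by
      intro q j
      have := congrFun (hη q) j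
      rw [Pi.smul_apply, smul_eq_mul] at this
      rw [← this]
    by_cases hg0 : rows κ₀ = 0
    · have : β.g (t i) = 0 := by
        ext Y
        rw [DoubleCellKill.g_eq_sum_rows, LinearMap.zero_apply]
        refine Finset.sum_eq_zero fun q _ => Finset.sum_eq_zero fun j _ => ?_
        beta_reduce
        rw [hentry, hg0, Pi.zero_apply, mul_zero, zero_mul]
      rw [this]; exact W.zero_mem
    · have hνη : ν ⬝ᵥ η = 0 := by
        have h : (ν ⬝ᵥ η) • rows κ₀ = 0 := by
          rw [← hcombo, dotProduct, Finset.sum_smul]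
          exact Finset.sum_congr rfl fun κ _ => by rw [hη κ, smul_smul]
        exact (smul_eq_zero.mp h).resolve_right hg0
      obtain ⟨s, hs⟩ := hperp η hνη
      refine ⟨s • rows κ₀, V.smul_mem s hgV, ?_⟩
      ext Y
      rw [DoubleCellKill.g_eq_sum_rows]
      simp only [Φ, LinearMap.coe_mk, AddHom.coe_mk, Pi.smul_apply, smul_eq_mul]
      refine Finset.sum_congr rfl fun q _ => Finset.sum_congr rfl fun j _ => ?_
      rw [hentry, hs, Pi.smul_apply, smul_eq_mul]; ring
  -- three independent vectors in a space of finrank ≤ 2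
  have hli : LinearIndependent k (fun i : Fin 3 => (⟨β.g (t i), hmem i⟩ : W)) :=
    LinearIndependent.of_comp W.subtype (by exact hind)
  have h3 := hli.fintype_card_le_finrank
  rw [Fintype.card_fin] at h3
  omega

end AllOnesRow

end Summit.MatrixMultiplication.OmegaCensus.SmallFormats
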